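import Literature.AlgebraicGeometry.Frobenioids.FrobeniusTypePrime
import Literature.AlgebraicGeometry.Frobenioids.PullbackLinear
import Literature.AlgebraicGeometry.Frobenioids.IsotropicFrobeniusTrivial
import HarnessLib

/-!
# Frobenioids I, Proposition 1.14 (Irreducible Morphisms), parts (i), (iv)

Mochizuki, *The geometry of Frobenioids I: the general theory*, Kyushu J. Math. **62** (2008)
293–400, §1, Proposition 1.14 (i), (iv) and their proofs, kurims text pp. 41–43
[cite: MochizukiFrdI2008, Prop. 1.14]. Standing data: `Φ` a divisorial monoid on a connected,
totally epimorphic category `D`; `C → F_Φ` a Frobenioid (`hF`) of isotropic type (`hist`).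

> "(i) `φ` is irreducible if and only if `φ` is one of the following: (a) a prime-Frobenius
> morphism; (b) a step such that `Div(φ)` is irreducible; (c) a pull-back morphism such that
> `Base(φ)` is an irreducible morphism of `D`.
> (iv) Let `α ∘ β = β′ ∘ α′` be an equality of composites of `C`, where `deg_Fr(β) = deg_Fr(β′)`,
> and `α`, `α′` are irreducible. Then `α` is a prime-Frobenius morphism if and only if `α′` is;
> moreover, `deg_Fr(α) = deg_Fr(α′)`."

Everything here is PROVED along the printed proof (pp. 41, 43): sufficiency in (i) for (a) is
Prop. 1.10 (iv), for (c) Prop. 1.11 (vi), and for (b) the divisor calculus of Remark 1.1.1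
together with isotropy (Prop. 1.4 (i): in a Frobenioid of isotropic type every morphism is
co-angular — `isCoAngular_of_isOfIsotropicType` of `IsotropicFrobeniusTrivial.lean` — and an
isometric pre-step is an isomorphism); necessity goes through the
factorisation of Def. 1.3 (iv)(a), Props. 1.10 (iv), 1.11 (vi) and — for steps — the divisor
equivalences of Def. 1.3 (iii)(d). (iv) is Remark 1.1.1 plus (i). The printed standing hypothesis
"`D` of FSMFF-type" is not used in (i), (iv) (it enters (ii), (iii)); parts (ii), (iii), (v) are
proved in the companion files `IrreducibleMorphismsPreSteps.lean`, `IrreducibleMorphismsChains.lean`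
(the implication "non-pre-step ⟹ bounded chains"; see there for the status of the converse),
`IrreducibleMorphismsDivIdentity.lean`.

Renderings (recorded for the referee). Composition is diagrammatic (`β ≫ α` is the text's
`α ∘ β`); "`Div(φ)` is irreducible" is `IsIrreducibleElt (Div F φ)` of the landed `Monoids.lean`
(multiplicative rendering); "irreducible morphism" is `IsIrreducibleHom` of the landed
`CategoriesFactorization.lean`. No statement of the paper is strengthened.
-/

namespace Literature.AlgebraicGeometry.Frobenioids

open CategoryTheory Opposite

universe w v v' u u'

namespace PreFrobenioid

variable {D : Type u} [Category.{v} D] {Φ : Dᵒᵖ ⥤ CommMonCat.{w}}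
  {C : Type u'} [Category.{v'} C] (F : C ⥤ ElemFrobenioid Φ)

/-! ### Proposition 1.14 (i): sufficiency of (a), (b), (c) -/

/-- **Prop. 1.14 (i)**, sufficiency of (b): in a Frobenioid of isotropic type a step `φ` with
`Div(φ)` irreducible is irreducible (a factorisation `φ = α ∘ β` consists of pre-steps, Prop. 1.7
(v), and `Div(φ) = Base(β)^* Div(α) + Div(β)`, Remark 1.1.1; so one of `α`, `β` is an isometric
pre-step, hence an isomorphism by isotropy). [cite: MochizukiFrdI2008, Prop. 1.14(i) p.41] -/
theorem isIrreducibleHom_of_isStep (hP : IsPreFrobenioid Φ F) (hist : IsOfIsotropicType F)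
    {A B : C} {φ : A ⟶ B} (hφ : IsStep F φ) (hdiv : IsIrreducibleElt (Div F φ)) :
    IsIrreducibleHom φ := by
  refine ⟨hφ.2, fun X β α h => ?_⟩
  have hpre : IsPreStep F α ∧ IsPreStep F β :=
    isPreStep_factors F hP.isTotallyEpimorphic_base (h.symm ▸ hφ.1)
  have hd : Div F φ = pull Φ (Base F β) (Div F α) * Div F β := by
    rw [← h, div_comp, show degFr F α = 1 from hpre.1.1, PNat.one_coe, pow_one]
  rcases hdiv.2 _ _ hd with h1 | h1
  · -- `Base(β)^* Div(α) = 0`, hence `Div(α) = 0` (`Base(β)` is an isomorphism)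
    haveI : IsIso (Base F β) := hpre.2.2
    have hα : IsIsometry F α := by
      have h2 := congrArg (pull Φ (inv (Base F β))) h1
      rw [← pull_comp, IsIso.inv_hom_id, pull_id, map_one] at h2
      exact h2
    exact Or.inl (hist X α hα hpre.1)
  · exact Or.inr (hist A β h1 hpre.2)

/-- **Prop. 1.14 (i)**, sufficiency: each of (a) prime-Frobenius [Prop. 1.10 (iv)], (b) step with
irreducible zero divisor, (c) pull-back morphism with irreducible projection [Prop. 1.11 (vi)]
is irreducible. [cite: MochizukiFrdI2008, Prop. 1.14(i) p.41] -/
theorem isIrreducibleHom_of_trichotomy (hF : IsFrobenioid F) (hist : IsOfIsotropicType F)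
    {A B : C} {φ : A ⟶ B}
    (h : IsPrimeFrobenius F φ ∨ (IsStep F φ ∧ IsIrreducibleElt (Div F φ)) ∨
      (IsPullbackMorphism F φ ∧ IsIrreducibleHom (Base F φ))) :
    IsIrreducibleHom φ := by
  rcases h with ha | ⟨hb₁, hb₂⟩ | ⟨hc₁, hc₂⟩
  · exact ha.isIrreducibleHom hF (hist A)
  · exact isIrreducibleHom_of_isStep F hF.isPreFrobenioid hist hb₁ hb₂
  · exact (isIrreducibleHom_iff_of_isPullbackMorphism hF hc₁).mpr hc₂

/-! ### Proposition 1.14 (i): necessity -/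

/-- In a Frobenioid of isotropic type, a step `φ : A → B` that is an irreducible morphism has
irreducible zero divisor: a factorisation `Div(φ) = x + y` with `x, y ≠ 0` lifts, by the
equivalence `^A(C^coa-pre) → Order(Φ(A))` of Def. 1.3 (iii)(d), to a factorisation of `φ` by two
co-angular pre-steps, neither of which is an isomorphism (Remark 1.1.1, `Φ` sharp and integral).
[cite: MochizukiFrdI2008, Prop. 1.14(i) p.41] -/
theorem isIrreducibleElt_div_of_isIrreducibleHom (hF : IsFrobenioid F) (hist : IsOfIsotropicType F)
    {A B : C} {φ : A ⟶ B} (hps : IsPreStep F φ) (hφ : IsIrreducibleHom φ) :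
    IsIrreducibleElt (Div F φ) := by
  have hP : IsPreFrobenioid Φ F := hF.isPreFrobenioid
  refine ⟨fun h1 => hφ.1 (hist A φ h1 hps), fun x y hxy => ?_⟩
  by_contra hcon
  have hx : x ≠ 1 := fun hx => hcon (Or.inl hx)
  have hy : y ≠ 1 := fun hy => hcon (Or.inr hy)
  -- a co-angular pre-step `β₁ : A → X₁` with `Div(β₁) = y ≤ Div(φ)` and the induced `f` with
  -- `f ∘ β₁ = φ`
  obtain ⟨X₁, β₁, hβ₁, hdβ₁⟩ := hF.iii_d_under_surj A y
  have hφc : IsCoAngularPreStep F φ := ⟨isCoAngular_of_isOfIsotropicType F hist φ, hps⟩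
  obtain ⟨f, -, hfac⟩ := hF.iii_d_under_full β₁ φ hβ₁ hφc
    (by rw [hdβ₁, hxy]; exact Dvd.intro_left x rfl)
  rcases hφ.2 β₁ f hfac with hfi | hβi
  · -- `f` is an isomorphism: `Div(φ) = Div(β₁) = y`, so `x = 0`
    haveI := hfi
    have h2 : Div F φ = Div F β₁ := by
      rw [← hfac, div_comp, show Div F f = 1 from isIsometry_of_isIso F hP f, map_one, one_mul,
        show degFr F f = 1 from isLinear_of_isIso F f, PNat.one_coe, pow_one]
    rw [hdβ₁, hxy] at h2
    haveI : IsCancelMul (Φ.obj (op (baseObj F A))) :=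
      isIntegral_iff_isCancelMul.mp (hP.isDivisorial (baseObj F A)).isPreDivisorial.isIntegral
    exact hx (mul_right_cancel (h2.trans (one_mul y).symm))
  · -- `β₁` is an isomorphism: `y = Div(β₁) = 0`
    haveI := hβi
    exact hy (hdβ₁ ▸ isIsometry_of_isIso F hP β₁)

/-- **Prop. 1.14 (i)**, necessity: an irreducible morphism of a Frobenioid of isotropic type is
(a) prime-Frobenius, or (b) a step with irreducible zero divisor, or (c) a pull-back morphism
with irreducible projection to `D` (via the factorisation of Def. 1.3 (iv)(a) and Props. 1.7 (v),
1.10 (iv), 1.11 (vi)). [cite: MochizukiFrdI2008, Prop. 1.14(i) p.41] -/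
theorem trichotomy_of_isIrreducibleHom (hF : IsFrobenioid F) (hist : IsOfIsotropicType F)
    {A B : C} {φ : A ⟶ B} (hφ : IsIrreducibleHom φ) :
    IsPrimeFrobenius F φ ∨ (IsStep F φ ∧ IsIrreducibleElt (Div F φ)) ∨
      (IsPullbackMorphism F φ ∧ IsIrreducibleHom (Base F φ)) := by
  have hP : IsPreFrobenioid Φ F := hF.isPreFrobenioid
  obtain ⟨X, Y, γ, β, α, hcomp, hγ, hβ, hα⟩ := hF.iv_a_exists φ
  by_cases hγi : IsIso γ
  · by_cases hαi : IsIso α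
    · -- `φ` is a pre-step (an irreducible one, hence a step with irreducible zero divisor)
      have hps : IsPreStep F φ := by
        rw [← hcomp]
        exact IsPreStep.comp F (isPreStep_of_isIso F γ)
          (IsPreStep.comp F hβ (isPreStep_of_isIso F α))
      exact Or.inr (Or.inl ⟨⟨hps, hφ.1⟩,
        isIrreducibleElt_div_of_isIrreducibleHom F hF hist hps hφ⟩)
    · -- `α` is not an isomorphism, so `β ∘ γ` is: `φ` is a pull-back morphism
      have h2 := hφ.2 (γ ≫ β) α (by rw [Category.assoc, hcomp])
      haveI : IsIso (γ ≫ β) := h2.resolve_left hαi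
      have hpb : IsPullbackMorphism F φ := by
        rw [← hcomp, ← Category.assoc]
        exact IsPullbackMorphism.comp F (isPullbackMorphism_of_isIso F (γ ≫ β)) hα
      exact Or.inr (Or.inr ⟨hpb, (isIrreducibleHom_iff_of_isPullbackMorphism hF hpb).mp hφ⟩)
  · -- `γ` is not an isomorphism, so `α ∘ β` is: `φ` is of Frobenius type
    have h2 := hφ.2 γ (β ≫ α) hcomp
    haveI : IsIso (β ≫ α) := h2.resolve_right hγi
    have hft : IsFrobeniusType F φ := by
      rw [← hcomp]
      exact IsFrobeniusType.comp F hF hγ (isFrobeniusType_of_isIso F hP (β ≫ α))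
    exact Or.inl (isPrimeFrobenius_of_isIrreducibleHom hF hft hφ)

/-- **Prop. 1.14 (i)**: "`φ` is irreducible if and only if `φ` is one of the following: (a) a
prime-Frobenius morphism; (b) a step such that `Div(φ)` is irreducible; (c) a pull-back morphism
such that `Base(φ)` is an irreducible morphism of `D`" — in a Frobenioid of isotropic type.
[cite: MochizukiFrdI2008, Prop. 1.14(i) p.41] -/
theorem isIrreducibleHom_iff_trichotomy (hF : IsFrobenioid F) (hist : IsOfIsotropicType F)
    {A B : C} (φ : A ⟶ B) :
    IsIrreducibleHom φ ↔
      IsPrimeFrobenius F φ ∨ (IsStep F φ ∧ IsIrreducibleElt (Div F φ)) ∨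
        (IsPullbackMorphism F φ ∧ IsIrreducibleHom (Base F φ)) :=
  ⟨fun h => trichotomy_of_isIrreducibleHom F hF hist h,
    fun h => isIrreducibleHom_of_trichotomy F hF hist h⟩

/-- A consequence of (i) used for (iv): an irreducible morphism of a Frobenioid of isotropic
type is prime-Frobenius iff its Frobenius degree is not `1` (steps and pull-back morphisms are
linear, Def. 1.3 (iv)(b)). [cite: MochizukiFrdI2008, Prop. 1.14(iv) p.43] -/
theorem isPrimeFrobenius_iff_degFr_ne_one_of_isIrreducibleHom (hF : IsFrobenioid F)
    (hist : IsOfIsotropicType F) {A B : C} {φ : A ⟶ B} (hφ : IsIrreducibleHom φ) :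
    IsPrimeFrobenius F φ ↔ degFr F φ ≠ 1 := by
  constructor
  · intro h h1
    have h2 := h.2
    rw [h1, PNat.one_coe] at h2
    exact Nat.not_prime_one h2
  · intro h
    rcases trichotomy_of_isIrreducibleHom F hF hist hφ with ha | ⟨hb, -⟩ | ⟨hc, -⟩
    · exact ha
    · exact (h hb.1.1).elim
    · exact (h (hF.iv_b φ hc).2).elim

/-! ### Proposition 1.14 (iv) -/

/-- **Prop. 1.14 (iv)**: "Let `α ∘ β = β′ ∘ α′` be an equality of composites of `C`, where
`deg_Fr(β) = deg_Fr(β′)`, and `α`, `α′` are irreducible. Then `α` is a prime-Frobenius morphism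
if and only if `α′` is; moreover, `deg_Fr(α) = deg_Fr(α′)`" (Remark 1.1.1 and (i)) — in a
Frobenioid of isotropic type. [cite: MochizukiFrdI2008, Prop. 1.14(iv) p.41] -/
theorem isPrimeFrobenius_iff_of_square (hF : IsFrobenioid F) (hist : IsOfIsotropicType F)
    {X Y Y' Z : C} {β : X ⟶ Y} {α : Y ⟶ Z} {α' : X ⟶ Y'} {β' : Y' ⟶ Z}
    (h : β ≫ α = α' ≫ β') (hdeg : degFr F β = degFr F β') (hα : IsIrreducibleHom α)
    (hα' : IsIrreducibleHom α') :
    (IsPrimeFrobenius F α ↔ IsPrimeFrobenius F α') ∧ degFr F α = degFr F α' := by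
  have hd : degFr F α = degFr F α' := by
    have h1 := congrArg (degFr F) h
    rw [degFr_comp, degFr_comp, hdeg, mul_comm] at h1
    exact PNat.eq (Nat.eq_of_mul_eq_mul_right (PNat.pos (degFr F β'))
      (by rw [← PNat.mul_coe, ← PNat.mul_coe, h1]))
  refine ⟨?_, hd⟩
  rw [isPrimeFrobenius_iff_degFr_ne_one_of_isIrreducibleHom F hF hist hα,
    isPrimeFrobenius_iff_degFr_ne_one_of_isIrreducibleHom F hF hist hα', hd]

end PreFrobenioid

end Literature.AlgebraicGeometry.Frobenioids
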